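import Literature.NumberTheory.GaloisRepresentations.HeckeCharacterAutConj
import HarnessLib

/-!
# The archimedean factor of an infinity type as a product over the complex EMBEDDINGS (totally complex field)
# (Weil 1956 §1: the type as an element of `ℤ[Hom(K, ℂ)]`)

Topic `NumberTheory/GaloisRepresentations`, namespace `Literature.NumberTheory.GaloisRepresentations.HeckeCharacter`;
sequel of `HeckeCharacterAutConj` (`typeOfExponent`, `filter_mk_eq`, `prod_embedding_zpow_eq` — the same identity
on PRINCIPAL infinite ideles `(k)_∞`, where `φ(k)` makes sense directly). PROOFS ONLY (no definition, no named fact,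
no `sorry`). For a general infinite idele `x ∈ (K ⊗ ℝ)ˣ` an embedding `φ : K → ℂ` is evaluated on the coordinate
`x_w`, `w = mk φ`, through the extension `ι_w : K_w → ℂ` of Mathlib's chosen embedding `σ_w = w.embedding` — as
`ι_w(x_w)` if `φ = σ_w` and as `conj(ι_w(x_w))` if `φ = σ̄_w`. With this reading the place-indexed archimedean factor
`A_{p,q}(x) = ∏_w ι_w(x_w)^{−p_w} conj(ι_w(x_w))^{−q_w}` of the type `(p, q) = typeOfExponent n` attached to an
exponent function `n ∈ ℤ[Hom(K, ℂ)]` is the embedding-indexed product `∏_φ φ̂(x)^{−n_φ}` — the form in which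
infinity types transport along field extensions (restriction of embeddings) without case distinctions on Mathlib's
choice of `w.embedding`. Requested by route `BiquadraticEisensteinDescent` of `Summits/BirchSwinnertonDyer` (crux
`EisensteinHeartFlatCMInertBadKPrime`, hypothesis (T) of `…KatzHsiehDisplay`: the Katz type of `λ · χ∘N_{L/K′}`),
as step (i) of the plan for the infinity type of `χ.compRelNorm L` recorded in that crux's V2 memo.

References: [Weil1956] §1; [SerreAbelianLadic1968] Ch. II §2.4.
-/

noncomputable section

open scoped NumberField ComplexConjugate Classical
open NumberField InfinitePlace NumberField.InfinitePlace.Completion Finset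

namespace Literature.NumberTheory.GaloisRepresentations

namespace HeckeCharacter

variable {K : Type} [Field K] [NumberField K]

/-- **`A_{typeOfExponent n}(x) = ∏_φ φ̂(x_{w_φ})^{−n_φ}` on a totally complex field**, where for an embedding `φ` with
place `w = mk φ` the value `φ̂(x_w)` is `ι_w(x_w)` if `φ = σ_w` (Mathlib's embedding of `w`) and `conj(ι_w(x_w))` if
`φ = σ̄_w` (`ι_w = extensionEmbedding w`). The fibre of `mk` over `w` is `{σ_w, σ̄_w}` (`filter_mk_eq`), two distinct
embeddings at a complex place, carrying the exponents `p_w = n(σ_w)` and `q_w = n(σ̄_w)` of `typeOfExponent n`.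
[cite: Weil1956, §1] [cite: SerreAbelianLadic1968, Ch. II §2.4] -/
theorem archFactor_typeOfExponent_eq_prod_embeddings [IsTotallyComplex K] (n : (K →+* ℂ) → ℤ)
    (x : (InfiniteAdeleRing K)ˣ) :
    archFactor (typeOfExponent n).1 (typeOfExponent n).2 x =
      ∏ φ : K →+* ℂ,
        (if φ = (InfinitePlace.mk φ).embedding
          then extensionEmbedding (InfinitePlace.mk φ) ((x : InfiniteAdeleRing K) (InfinitePlace.mk φ))
          else conj (extensionEmbedding (InfinitePlace.mk φ) ((x : InfiniteAdeleRing K) (InfinitePlace.mk φ))))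
          ^ (-n φ) := by
  classical
  rw [archFactor_apply, ← Finset.prod_fiberwise Finset.univ (fun φ : K →+* ℂ ↦ InfinitePlace.mk φ)]
  refine Finset.prod_congr rfl fun w _ ↦ ?_
  rw [filter_mk_eq]
  have hw : ¬ w.IsReal := not_isReal_iff_isComplex.mpr (IsTotallyComplex.isComplex w)
  have hne : w.embedding ≠ ComplexEmbedding.conjugate w.embedding := by
    intro h
    exact hw (isReal_iff.mpr (ComplexEmbedding.isReal_iff.mpr h.symm))
  rw [Finset.prod_pair hne]
  -- the two factors: `φ = σ_w` and `φ = σ̄_w` (the place-dependence is discharged through `hF`)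
  have hF : ∀ {v : InfinitePlace K}, v = w →
      extensionEmbedding v ((x : InfiniteAdeleRing K) v) = extensionEmbedding w ((x : InfiniteAdeleRing K) w) :=
    fun h ↦ by subst h; rfl
  have hmk₁ : InfinitePlace.mk w.embedding = w := mk_embedding w
  have hmk₂ : InfinitePlace.mk (ComplexEmbedding.conjugate w.embedding) = w := by
    rw [mk_conjugate_eq, mk_embedding]
  have hc₁ : w.embedding = (InfinitePlace.mk w.embedding).embedding := by rw [hmk₁]
  have hc₂ : ¬ ComplexEmbedding.conjugate w.embedding =
      (InfinitePlace.mk (ComplexEmbedding.conjugate w.embedding)).embedding := by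
    rw [hmk₂]; exact hne.symm
  rw [if_pos hc₁, if_neg hc₂, hF hmk₁, hF hmk₂]
  -- the exponents
  simp only [typeOfExponent, if_neg hw]

end HeckeCharacter

end Literature.NumberTheory.GaloisRepresentations

end
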